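import Summits.Ventures.Crystal3D.Theorems.StickyWulffConstantNoReconstructionGainInterstitialGain
import HarnessLib

/-!
# The gain bound for films on BOTH sides of the slab sample (no "above the cut" hypothesis)

HONEST FRAMING. Part of the venture `Summits/Ventures/Crystal3D` (cell `crystal3d-full`), helper
`--supports` the crux `NoReconstructionGain` (stmt-Ventures-19144, route
`route-Ventures-StickyWulffConstant`), line `adhesion` (wulff-p1 g10); companion of
`…InterstitialGain`, answering the bookkeeping question "films below / beside the slab" in cap
currency.  Orient every ball by its side of the slab's mid-plane (`ν_q = ν` if `⟪q,ν⟫ > −3R/2`,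
else `−ν`; `R = 4`) and run the cap transfer of `…InterstitialGain` with `ν_q` at every ball: it
stays antisymmetric, VANISHES between film balls on opposite sides, and `perBall_capAccount` (valid
for every direction) shows that such a discordant contact costs at most one unit, and only when it
is INVERTED — registered, seen from either ball, to a cap pointing away from the slab (a shallow
bond; impossible for an exact lattice bond).  Substrate balls sit in an outward cap of a film ball
only on the rim (thickness `4` leaves room for the blocked slot on either side).

* `interstitialGain_twoSided` (`R = 4`, `C = 3072`): for every bond star `U`, unit `ν`, `ρ ≥ 4`,
  finite unit packing `X ⊇ P` (`P` the `ν`-slab sample), with NO hypothesis on where the film lies: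
  `#cross(P, X∖P) ≤ D(X∖P) + Σ_q [a_{ν_q}(q) − v_{ν_q}(q)] + ½·#{discordant inverted ordered pairs}
  + C ρ`.  The discordant term vanishes for films with no contact across the mid-plane outside the
  slab (e.g. films on both faces that do not wrap the rim) and for exact lattice films always.

WHAT THIS IS NOT: a bound on the discordant term for bulk amorphous material beside the slab (the
two-sided atom for such films is as hard as the crux); rung F-C1 not moved.
-/

noncomputable section

namespace Summit.Ventures.Crystal3D.Theorems

open Summit.Ventures.Crystal3D Finset
open Literature.MathematicalPhysics.StatisticalMechanics (fccStacking orderedContacts contactDeficiency)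
open scoped InnerProductSpace

/-- **Two-sided gain bound** (see the module docstring). -/
theorem interstitialGain_twoSided :
    ∃ R C : ℝ, 1 ≤ R ∧ ∀ U : Finset (EuclideanSpace ℝ (Fin 3)),
      (∀ d ∈ U, d ∈ fccStacking 1 (Real.sqrt (2 / 3)) ∧ ‖d‖ = 1) → (∀ d ∈ U, -d ∈ U) → U.card = 12 →
      ∀ ν : EuclideanSpace ℝ (Fin 3), ‖ν‖ = 1 → ∀ ρ : ℝ, R ≤ ρ →
      ∀ X P : Finset (EuclideanSpace ℝ (Fin 3)),
      (∀ p ∈ X, ∀ q ∈ X, p ≠ q → 1 ≤ dist p q) → P ⊆ X →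
      (∀ p, p ∈ P ↔ (p ∈ fccStacking 1 (Real.sqrt (2 / 3)) ∧ -(2 * R) ≤ ⟪p, ν⟫_ℝ ∧
        ⟪p, ν⟫_ℝ ≤ -R ∧ ‖p‖ ^ 2 - ⟪p, ν⟫_ℝ ^ 2 ≤ ρ ^ 2)) →
      ((((P ×ˢ (X \ P)).filter fun pq => dist pq.1 pq.2 = 1).card : ℕ) : ℝ) ≤
        contactDeficiency (X \ P)
          + ∑ q ∈ X \ P,
            (((P.filter fun p => dist q p = 1 ∧ ∀ d ∈ U, ⟪p - q, d⟫_ℝ ≤ Real.sqrt 3 / 2).card : ℝ)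
              + (((X \ P).filter fun x => dist q x = 1 ∧ (∀ d ∈ U, ⟪x - q, d⟫_ℝ ≤ Real.sqrt 3 / 2) ∧
                  ⟪x, if -(3 * R / 2) < ⟪q, ν⟫_ℝ then ν else -ν⟫_ℝ <
                    ⟪q, if -(3 * R / 2) < ⟪q, ν⟫_ℝ then ν else -ν⟫_ℝ).card : ℝ)
              + (1 / 2) * (((X \ P).filter fun x => dist q x = 1 ∧ (∀ d ∈ U, ⟪x - q, d⟫_ℝ ≤ Real.sqrt 3 / 2) ∧
                  ⟪x, if -(3 * R / 2) < ⟪q, ν⟫_ℝ then ν else -ν⟫_ℝ =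
                    ⟪q, if -(3 * R / 2) < ⟪q, ν⟫_ℝ then ν else -ν⟫_ℝ).card : ℝ)
              - ((U.filter fun d => ⟪d, if -(3 * R / 2) < ⟪q, ν⟫_ℝ then ν else -ν⟫_ℝ < 0 ∧
                  ∀ x ∈ X, dist q x = 1 → ⟪x - q, d⟫_ℝ ≤ Real.sqrt 3 / 2).card : ℝ)
              - (1 / 2) * ((U.filter fun d => ⟪d, if -(3 * R / 2) < ⟪q, ν⟫_ℝ then ν else -ν⟫_ℝ = 0 ∧
                  ∀ x ∈ X, dist q x = 1 → ⟪x - q, d⟫_ℝ ≤ Real.sqrt 3 / 2).card : ℝ)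
              + (1 / 2) * (((X \ P).filter fun x => dist q x = 1 ∧
                  ¬ ((-(3 * R / 2) < ⟪q, ν⟫_ℝ) ↔ (-(3 * R / 2) < ⟪x, ν⟫_ℝ)) ∧
                  ∃ d ∈ U, 0 < ⟪d, if -(3 * R / 2) < ⟪q, ν⟫_ℝ then ν else -ν⟫_ℝ ∧
                    Real.sqrt 3 / 2 < ⟪x - q, d⟫_ℝ).card : ℝ))
          + C * ρ := by
  classical
  refine ⟨4, 3072, by norm_num, ?_⟩
  intro U hU hUneg hUcard ν hν ρ hρ X P hX hPX hP
  set c : ℝ := Real.sqrt 3 / 2 with hc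
  have hm : -(3 * (4 : ℝ) / 2) = -6 := by norm_num
  simp only [hm]
  -- the oriented normal of a ball
  set nq : EuclideanSpace ℝ (Fin 3) → EuclideanSpace ℝ (Fin 3) := fun q => if -6 < ⟪q, ν⟫_ℝ then ν else -ν with hnq
  have hnq_pos : ∀ q, -6 < ⟪q, ν⟫_ℝ → nq q = ν := fun q h => by simp only [hnq]; rw [if_pos h]
  have hnq_neg : ∀ q, ¬ -6 < ⟪q, ν⟫_ℝ → nq q = -ν := fun q h => by simp only [hnq]; rw [if_neg h]
  have hnq_opp : ∀ q x, ¬ ((-6 < ⟪q, ν⟫_ℝ) ↔ (-6 < ⟪x, ν⟫_ℝ)) → nq x = -nq q := by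
    intro q x h
    by_cases h1 : -6 < ⟪q, ν⟫_ℝ
    · by_cases h2 : -6 < ⟪x, ν⟫_ℝ
      · exact absurd ⟨fun _ => h2, fun _ => h1⟩ h
      · rw [hnq_neg x h2, hnq_pos q h1]
    · by_cases h2 : -6 < ⟪x, ν⟫_ℝ
      · rw [hnq_pos x h2, hnq_neg q h1, neg_neg]
      · exact absurd ⟨fun h' => absurd h' h1, fun h' => absurd h' h2⟩ h
  have hnq_same : ∀ q x, ((-6 < ⟪q, ν⟫_ℝ) ↔ (-6 < ⟪x, ν⟫_ℝ)) → nq x = nq q := by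
    intro q x h
    by_cases h1 : -6 < ⟪q, ν⟫_ℝ
    · rw [hnq_pos q h1, hnq_pos x (h.1 h1)]
    · rw [hnq_neg q h1, hnq_neg x (fun h2 => h1 (h.2 h2))]
  -- discordant pairs: the partner is `nq q`-below `q`
  have hbelow : ∀ q x, ¬ ((-6 < ⟪q, ν⟫_ℝ) ↔ (-6 < ⟪x, ν⟫_ℝ)) → ⟪x, nq q⟫_ℝ < ⟪q, nq q⟫_ℝ := by
    intro q x h
    by_cases h1 : -6 < ⟪q, ν⟫_ℝ
    · have h2 : ¬ -6 < ⟪x, ν⟫_ℝ := fun h2 => h ⟨fun _ => h2, fun _ => h1⟩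
      rw [hnq_pos q h1]; linarith [not_lt.1 h2]
    · have h2 : -6 < ⟪x, ν⟫_ℝ := by by_contra h2; exact h ⟨fun h' => absurd h' h1, fun h' => absurd h' h2⟩
      rw [hnq_neg q h1, inner_neg_right, inner_neg_right]; linarith [not_lt.1 h1]
  -- per-ball quantities
  set cP : EuclideanSpace ℝ (Fin 3) → ℝ := fun q => ((P.filter fun p => dist q p = 1).card : ℝ) with hcP
  set dF : EuclideanSpace ℝ (Fin 3) → ℝ := fun q =>
    (((X \ P).filter fun x => dist q x = 1).card : ℝ) with hdF
  -- the oriented cap transfer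
  set g : EuclideanSpace ℝ (Fin 3) → EuclideanSpace ℝ (Fin 3) → ℤ := fun x y =>
    (if ∃ d ∈ U, ⟪d, nq y⟫_ℝ < 0 ∧ c < ⟪x - y, d⟫_ℝ then (1 : ℤ) else 0)
      + (if (∀ d ∈ U, ⟪x - y, d⟫_ℝ ≤ c) ∧ ⟪x, nq y⟫_ℝ < ⟪y, nq y⟫_ℝ then (1 : ℤ) else 0) with hg
  set t : EuclideanSpace ℝ (Fin 3) → EuclideanSpace ℝ (Fin 3) → ℤ := fun x y => g x y - g y x with ht
  have ht_anti : ∀ x y, t x y = -t y x := fun x y => by simp only [ht]; ring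
  -- the summand of the per-ball accounting at `q` (direction `nq q`), and its comparison with `t`
  set k : EuclideanSpace ℝ (Fin 3) → EuclideanSpace ℝ (Fin 3) → ℤ := fun x q =>
    ((if ∃ d ∈ U, ⟪d, nq q⟫_ℝ < 0 ∧ c < ⟪x - q, d⟫_ℝ then (1 : ℤ) else 0)
      + (if (∀ d ∈ U, ⟪x - q, d⟫_ℝ ≤ c) ∧ ⟪x, nq q⟫_ℝ < ⟪q, nq q⟫_ℝ then (1 : ℤ) else 0))
    - ((if ∃ d ∈ U, ⟪d, nq q⟫_ℝ < 0 ∧ c < ⟪q - x, d⟫_ℝ then (1 : ℤ) else 0)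
      + (if (∀ d ∈ U, ⟪q - x, d⟫_ℝ ≤ c) ∧ ⟪q, nq q⟫_ℝ < ⟪x, nq q⟫_ℝ then (1 : ℤ) else 0)) with hk
  set inv : EuclideanSpace ℝ (Fin 3) → EuclideanSpace ℝ (Fin 3) → ℤ := fun x q =>
    if ¬ ((-6 < ⟪q, ν⟫_ℝ) ↔ (-6 < ⟪x, ν⟫_ℝ)) ∧ ∃ d ∈ U, 0 < ⟪d, nq q⟫_ℝ ∧ c < ⟪x - q, d⟫_ℝ
    then (1 : ℤ) else 0 with hinv
  have htk : ∀ q x, t x q ≤ k x q + inv x q := by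
    intro q x
    by_cases hs : (-6 < ⟪q, ν⟫_ℝ) ↔ (-6 < ⟪x, ν⟫_ℝ)
    · -- concordant: `t = k`
      have e := hnq_same q x hs
      have : t x q = k x q := by simp only [ht, hg, hk, e]
      have hi : inv x q = 0 := by simp only [hinv]; rw [if_neg]; exact fun h => h.1 hs
      rw [this, hi, add_zero]
    · -- discordant: `t = 0`, and `k ≥ -inv`
      have e := hnq_opp q x hs
      have hb := hbelow q x hs
      have hsym_int : (∀ d ∈ U, ⟪q - x, d⟫_ℝ ≤ c) ↔ (∀ d ∈ U, ⟪x - q, d⟫_ℝ ≤ c) := by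
        constructor <;> intro h d hd <;> have := h (-d) (hUneg d hd) <;>
          rwa [inner_neg_right, ← inner_neg_left, neg_sub] at this
      have flip : ∀ d y z : EuclideanSpace ℝ (Fin 3), c < ⟪y - z, d⟫_ℝ → c < ⟪z - y, -d⟫_ℝ := fun d y z h => by
        rwa [inner_neg_right, ← inner_neg_left, neg_sub]
      have hsym_capA : (∃ d ∈ U, ⟪d, nq x⟫_ℝ < 0 ∧ c < ⟪q - x, d⟫_ℝ) ↔
          (∃ d ∈ U, ⟪d, nq q⟫_ℝ < 0 ∧ c < ⟪x - q, d⟫_ℝ) := by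
        rw [e]
        constructor <;> rintro ⟨d, hd, hdν, hdx⟩ <;> refine ⟨-d, hUneg d hd, ?_, flip d _ _ hdx⟩
        · rw [inner_neg_left]; rw [inner_neg_right] at hdν; linarith
        · rw [inner_neg_left, inner_neg_right]; linarith
      have hsym_capB : (∃ d ∈ U, ⟪d, nq q⟫_ℝ < 0 ∧ c < ⟪q - x, d⟫_ℝ) ↔
          (∃ d ∈ U, 0 < ⟪d, nq q⟫_ℝ ∧ c < ⟪x - q, d⟫_ℝ) := by
        constructor <;> rintro ⟨d, hd, hdν, hdx⟩ <;>
          exact ⟨-d, hUneg d hd, by rw [inner_neg_left]; linarith, flip d _ _ hdx⟩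
      have hgt : g q x = g x q := by
        simp only [hg]
        rw [if_congr hsym_capA rfl rfl]
        have e2 : ((∀ d ∈ U, ⟪q - x, d⟫_ℝ ≤ c) ∧ ⟪q, nq x⟫_ℝ < ⟪x, nq x⟫_ℝ) ↔
            ((∀ d ∈ U, ⟪x - q, d⟫_ℝ ≤ c) ∧ ⟪x, nq q⟫_ℝ < ⟪q, nq q⟫_ℝ) := by
          rw [hsym_int, e, inner_neg_right, inner_neg_right, neg_lt_neg_iff]
        rw [if_congr e2 rfl rfl]
      have ht0 : t x q = 0 := by simp only [ht]; rw [hgt]; ring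
      rw [ht0]
      -- lower bound for `k x q + inv x q`
      have hk' : k x q = ((if ∃ d ∈ U, ⟪d, nq q⟫_ℝ < 0 ∧ c < ⟪x - q, d⟫_ℝ then (1 : ℤ) else 0)
          + (if (∀ d ∈ U, ⟪x - q, d⟫_ℝ ≤ c) ∧ ⟪x, nq q⟫_ℝ < ⟪q, nq q⟫_ℝ then (1 : ℤ) else 0))
          - ((if ∃ d ∈ U, 0 < ⟪d, nq q⟫_ℝ ∧ c < ⟪x - q, d⟫_ℝ then (1 : ℤ) else 0)
          + (if (∀ d ∈ U, ⟪x - q, d⟫_ℝ ≤ c) ∧ ⟪q, nq q⟫_ℝ < ⟪x, nq q⟫_ℝ then (1 : ℤ) else 0)) := by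
        simp only [hk]
        rw [if_congr hsym_capB rfl rfl, if_congr (and_congr hsym_int Iff.rfl) rfl rfl]
      have hinv' : inv x q = (if ∃ d ∈ U, 0 < ⟪d, nq q⟫_ℝ ∧ c < ⟪x - q, d⟫_ℝ then (1 : ℤ) else 0) := by
        simp only [hinv]
        by_cases h' : ∃ d ∈ U, 0 < ⟪d, nq q⟫_ℝ ∧ c < ⟪x - q, d⟫_ℝ
        · rw [if_pos ⟨hs, h'⟩, if_pos h']
        · rw [if_neg (fun h => h' h.2), if_neg h']
      have hno : ¬ ((∀ d ∈ U, ⟪x - q, d⟫_ℝ ≤ c) ∧ ⟪q, nq q⟫_ℝ < ⟪x, nq q⟫_ℝ) := fun h => by linarith [h.2]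
      rw [hk', hinv', if_neg hno]
      have h0 : (0 : ℤ) ≤ (if ∃ d ∈ U, ⟪d, nq q⟫_ℝ < 0 ∧ c < ⟪x - q, d⟫_ℝ then (1 : ℤ) else 0) := by
        split_ifs <;> norm_num
      have h1 : (0 : ℤ) ≤ (if (∀ d ∈ U, ⟪x - q, d⟫_ℝ ≤ c) ∧ ⟪x, nq q⟫_ℝ < ⟪q, nq q⟫_ℝ then (1 : ℤ) else 0) := by
        split_ifs <;> norm_num
      linarith
  -- real-valued per-ball sums
  set S : EuclideanSpace ℝ (Fin 3) → ℝ := fun q =>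
    ((∑ x ∈ (X \ P).filter (fun x => dist q x = 1), t x q : ℤ) : ℝ) with hS
  set K : EuclideanSpace ℝ (Fin 3) → ℝ := fun q =>
    ((∑ x ∈ (X \ P).filter (fun x => dist q x = 1), k x q : ℤ) : ℝ) with hK
  set I : EuclideanSpace ℝ (Fin 3) → ℝ := fun q =>
    (((X \ P).filter fun x => dist q x = 1 ∧ ¬ ((-6 < ⟪q, ν⟫_ℝ) ↔ (-6 < ⟪x, ν⟫_ℝ)) ∧
      ∃ d ∈ U, 0 < ⟪d, nq q⟫_ℝ ∧ c < ⟪x - q, d⟫_ℝ).card : ℝ) with hI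
  have hSKI : ∀ q, S q ≤ K q + I q := by
    intro q
    have h1 : (∑ x ∈ (X \ P).filter (fun x => dist q x = 1), t x q : ℤ) ≤
        ∑ x ∈ (X \ P).filter (fun x => dist q x = 1), (k x q + inv x q) := sum_le_sum fun x _ => htk q x
    rw [sum_add_distrib] at h1
    have h2 : (∑ x ∈ (X \ P).filter (fun x => dist q x = 1), inv x q : ℤ) =
        (((X \ P).filter fun x => dist q x = 1 ∧ ¬ ((-6 < ⟪q, ν⟫_ℝ) ↔ (-6 < ⟪x, ν⟫_ℝ)) ∧
          ∃ d ∈ U, 0 < ⟪d, nq q⟫_ℝ ∧ c < ⟪x - q, d⟫_ℝ).card : ℤ) := by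
      rw [← filter_filter, card_filter, Nat.cast_sum]
      refine sum_congr rfl fun x _ => ?_
      simp only [hinv, Nat.cast_ite, Nat.cast_one, Nat.cast_zero]
    rw [h2] at h1
    have h3 := (Int.cast_le (R := ℝ)).2 h1
    simp only [hS, hK, hI]
    push_cast at h3 ⊢
    linarith
  -- the summand of the statement
  set f : EuclideanSpace ℝ (Fin 3) → ℝ := fun q =>
    ((P.filter fun p => dist q p = 1 ∧ ∀ d ∈ U, ⟪p - q, d⟫_ℝ ≤ c).card : ℝ)
      + (((X \ P).filter fun x => dist q x = 1 ∧ (∀ d ∈ U, ⟪x - q, d⟫_ℝ ≤ c) ∧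
          ⟪x, nq q⟫_ℝ < ⟪q, nq q⟫_ℝ).card : ℝ)
      + (1 / 2) * (((X \ P).filter fun x => dist q x = 1 ∧ (∀ d ∈ U, ⟪x - q, d⟫_ℝ ≤ c) ∧
          ⟪x, nq q⟫_ℝ = ⟪q, nq q⟫_ℝ).card : ℝ)
      - ((U.filter fun d => ⟪d, nq q⟫_ℝ < 0 ∧ ∀ x ∈ X, dist q x = 1 → ⟪x - q, d⟫_ℝ ≤ c).card : ℝ)
      - (1 / 2) * ((U.filter fun d => ⟪d, nq q⟫_ℝ = 0 ∧ ∀ x ∈ X, dist q x = 1 → ⟪x - q, d⟫_ℝ ≤ c).card : ℝ)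
    with hf
  set B : EuclideanSpace ℝ (Fin 3) → ℝ := fun q =>
    ((P.filter fun p => dist q p = 1 ∧ ∃ d ∈ U, 0 ≤ ⟪d, nq q⟫_ℝ ∧ c < ⟪p - q, d⟫_ℝ).card : ℝ) with hB
  -- (1) per-ball accounting with the oriented normal
  have hkey : ∀ q ∈ X \ P, 2 * cP q + dF q + K q ≤ 12 + 2 * f q + 2 * B q := by
    intro q hq
    have hKq := perBall_capAccount X P hX hPX U hU hUneg hUcard (nq q) q hq
    set T := ∑ x ∈ (X \ P).filter (fun x => dist q x = 1), k x q with hT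
    rw [← hc] at hKq
    have hKq' := (Int.cast_le (R := ℝ)).2 hKq
    simp only [hcP, hdF, hK, hf, hB, ← hT]
    push_cast at hKq' ⊢
    linarith
  -- (2) telescoping
  have hs0 : ∑ q ∈ X \ P, S q = 0 := by
    simp only [hS]
    rw [← Int.cast_sum, sum_sum_transfer_eq_zero (X \ P) t ht_anti, Int.cast_zero]
  have hcross : ((((P ×ˢ (X \ P)).filter fun pq => dist pq.1 pq.2 = 1).card : ℕ) : ℝ) =
      ∑ q ∈ X \ P, cP q := card_cross_eq_sum_card_plug_partners P (X \ P)
  have hord : (orderedContacts (X \ P) : ℝ) = ∑ q ∈ X \ P, dF q :=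
    orderedContacts_eq_sum_card_partners (X \ P)
  have hdef : contactDeficiency (X \ P) =
      6 * ((X \ P).card : ℝ) - (orderedContacts (X \ P) : ℝ) / 2 := rfl
  -- (3) the rim term: substrate balls in an outward-or-level cap are in the lateral rim band
  set Prim := P.filter fun p => (ρ - 1) ^ 2 < ‖p‖ ^ 2 - ⟪p, ν⟫_ℝ ^ 2 with hPrim
  have h12 : ∀ e, (X.filter fun x => dist e x = 1).card ≤ 12 := fun e => card_partners_le_twelve X hX e
  have hnorm : ∀ x : EuclideanSpace ℝ (Fin 3),
      ‖((ℝ ∙ ν)ᗮ).orthogonalProjectionOnto x‖ ^ 2 = ‖x‖ ^ 2 - ⟪x, ν⟫_ℝ ^ 2 := by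
    intro x
    have e1 := Submodule.norm_sq_eq_add_norm_sq_projection x (ℝ ∙ ν)
    have e2' : ‖((ℝ ∙ ν).orthogonalProjectionOnto x : EuclideanSpace ℝ (Fin 3))‖ = |⟪x, ν⟫_ℝ| := by
      rw [Submodule.coe_orthogonalProjectionOnto_apply, Submodule.starProjection_singleton ℝ, norm_smul, hν,
        real_inner_comm]
      simp
    have e2 : ‖(ℝ ∙ ν).orthogonalProjectionOnto x‖ = |⟪x, ν⟫_ℝ| := by rw [← e2', Submodule.coe_norm]
    rw [e2, sq_abs] at e1
    linarith
  have hBq : ∀ q ∈ X \ P, B q ≤ ((Prim.filter fun p => dist q p = 1).card : ℝ) := by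
    intro q hq
    simp only [hB]
    refine Nat.cast_le.2 (card_le_card fun p hp => ?_)
    obtain ⟨hpP, hqp, d, hdU, hdν, hpd⟩ := mem_filter.1 hp
    obtain ⟨hpΛ, hpb, hpt, hplat⟩ := (hP p).1 hpP
    obtain ⟨hdΛ, hdn⟩ := hU d hdU
    refine mem_filter.2 ⟨mem_filter.2 ⟨hpP, ?_⟩, hqp⟩
    -- the slot `p - d` is blocked by `q`, lies in the slab's height range, hence is laterally outside
    have hu : ‖p - q‖ = 1 := by rw [← dist_eq_norm, dist_comm, hqp]
    have hlt : dist q (p - d) < 1 := by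
      rw [dist_eq_norm, show q - (p - d) = -((p - q) - d) by abel, norm_neg]
      exact norm_sub_lt_one_of_cap hu hdn hpd
    have hnotP : p - d ∉ P := by
      intro hmem
      by_cases hne : q = p - d
      · exact (mem_sdiff.1 hq).2 (hne ▸ hmem)
      · have := hX q (mem_sdiff.1 hq).1 (p - d) (hPX hmem) hne; linarith
    have hpq1 : |⟪p - q, ν⟫_ℝ| ≤ 1 := by
      have h := abs_real_inner_le_norm (p - q) ν
      rw [hν, mul_one, hu] at h; exact h
    have hdν1 : |⟪d, ν⟫_ℝ| ≤ 1 := by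
      have h := abs_real_inner_le_norm d ν
      rw [hν, mul_one, hdn] at h; exact h
    have hpq2 := abs_le.1 hpq1
    have hdν2 := abs_le.1 hdν1
    rw [inner_sub_left] at hpq2
    -- height of `p - d` stays in `[-8, -4]`
    have hh1 : -(2 * 4) ≤ ⟪p - d, ν⟫_ℝ ∧ ⟪p - d, ν⟫_ℝ ≤ -4 := by
      rw [inner_sub_left]
      by_cases h6 : -6 < ⟪q, ν⟫_ℝ
      · rw [hnq_pos q h6] at hdν
        constructor <;> linarith
      · rw [hnq_neg q h6, inner_neg_right] at hdν
        push Not at h6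
        constructor <;> linarith
    have hlat : ρ ^ 2 < ‖p - d‖ ^ 2 - ⟪p - d, ν⟫_ℝ ^ 2 := by
      by_contra hle
      push Not at hle
      exact hnotP ((hP (p - d)).2 ⟨fcc_sub_site_mem hpΛ hdΛ, hh1.1, hh1.2, hle⟩)
    have htri : ‖((ℝ ∙ ν)ᗮ).orthogonalProjectionOnto (p - d)‖ ≤
        ‖((ℝ ∙ ν)ᗮ).orthogonalProjectionOnto p‖ + ‖((ℝ ∙ ν)ᗮ).orthogonalProjectionOnto d‖ := by
      rw [map_sub]; exact norm_sub_le _ _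
    have hyd : ‖((ℝ ∙ ν)ᗮ).orthogonalProjectionOnto d‖ ≤ 1 := by
      have h1 := hnorm d
      rw [hdn] at h1
      by_contra hgt
      push Not at hgt
      have h2 := mul_self_lt_mul_self zero_le_one hgt
      nlinarith only [h1, h2, sq_nonneg ⟪d, ν⟫_ℝ]
    have hypd : ρ < ‖((ℝ ∙ ν)ᗮ).orthogonalProjectionOnto (p - d)‖ := by
      have h1 := hnorm (p - d)
      by_contra hle
      push Not at hle
      have h2 := mul_self_le_mul_self (norm_nonneg _) hle
      nlinarith only [h1, h2, hlat]
    have hyp : ρ - 1 < ‖((ℝ ∙ ν)ᗮ).orthogonalProjectionOnto p‖ := by linarith only [htri, hyd, hypd]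
    have h0 : 0 ≤ ρ - 1 := by linarith only [hρ]
    have hsq := mul_self_lt_mul_self h0 hyp
    have hyp2 := hnorm p
    nlinarith only [hsq, hyp2]
  have hBsum : ∑ q ∈ X \ P, B q ≤ 12 * (Prim.card : ℝ) := by
    have h1 : ∑ q ∈ X \ P, B q ≤ ∑ q ∈ X \ P, ((Prim.filter fun p => dist q p = 1).card : ℝ) :=
      sum_le_sum hBq
    have h2 : ∑ q ∈ X \ P, ((Prim.filter fun p => dist q p = 1).card : ℝ) =
        ∑ p ∈ Prim, (((X \ P).filter fun q => dist p q = 1).card : ℝ) := by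
      have e1 : ∀ q ∈ X \ P, ((Prim.filter fun p => dist q p = 1).card : ℝ) =
          ∑ p ∈ Prim, if dist q p = 1 then (1 : ℝ) else 0 := fun q _ => by
        rw [card_filter, Nat.cast_sum]; simp only [Nat.cast_ite, Nat.cast_one, Nat.cast_zero]
      have e2 : ∀ p ∈ Prim, (((X \ P).filter fun q => dist p q = 1).card : ℝ) =
          ∑ q ∈ X \ P, if dist q p = 1 then (1 : ℝ) else 0 := fun p _ => by
        rw [card_filter, Nat.cast_sum]
        simp only [Nat.cast_ite, Nat.cast_one, Nat.cast_zero, dist_comm]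
      rw [sum_congr rfl e1, sum_congr rfl e2, sum_comm]
    have h3 : ∑ p ∈ Prim, (((X \ P).filter fun q => dist p q = 1).card : ℝ) ≤ ∑ p ∈ Prim, (12 : ℝ) := by
      refine sum_le_sum fun p _ => ?_
      have := (card_le_card (filter_subset_filter (fun q => dist p q = 1) (sdiff_subset (s := X) (t := P)))).trans
        (h12 p)
      exact_mod_cast this
    rw [sum_const, nsmul_eq_mul] at h3
    linarith
  -- the rim band `(ρ-1)² < lateral² ≤ ρ²`, heights `[-8,-4]`: eight half-height bands of `≤ 32 ρ` each
  have hPrimcard : (Prim.card : ℝ) ≤ 256 * ρ := by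
    have hsep : ∀ S' : Finset (EuclideanSpace ℝ (Fin 3)), S' ⊆ Prim → ∀ p ∈ S', ∀ q ∈ S', p ≠ q → 1 ≤ dist p q :=
      fun S' hS p hp q hq hpq => hX p (hPX (mem_filter.1 (hS hp)).1) q (hPX (mem_filter.1 (hS hq)).1) hpq
    have hband : ∀ p ∈ Prim, (ρ - 1) ^ 2 ≤ ‖p‖ ^ 2 - ⟪p, ν⟫_ℝ ^ 2 ∧ ‖p‖ ^ 2 - ⟪p, ν⟫_ℝ ^ 2 ≤ ρ ^ 2 ∧
        -8 ≤ ⟪p, ν⟫_ℝ ∧ ⟪p, ν⟫_ℝ ≤ -4 := by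
      intro p hp
      obtain ⟨hpP, hlat⟩ := mem_filter.1 hp
      obtain ⟨-, h1, h2, h3⟩ := (hP p).1 hpP
      exact ⟨hlat.le, h3, by linarith, by linarith⟩
    -- split into the 8 half-height bands `[-8 + j/2, -8 + (j+1)/2]`
    have hcount : ∀ j : ℕ, j < 8 →
        ((Prim.filter fun p => -8 + (j : ℝ) / 2 ≤ ⟪p, ν⟫_ℝ ∧ ⟪p, ν⟫_ℝ ≤ -8 + ((j : ℝ) + 1) / 2).card : ℝ) ≤
          16 * (1 + 1) * ρ := by
      intro j hj
      refine card_shellBand_le ν hν _ (hsep _ (filter_subset _ _)) ρ 1 (-8 + (j : ℝ) / 2) (by norm_num)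
        (by linarith) fun x hx => ?_
      obtain ⟨hxB, hxt⟩ := mem_filter.1 hx
      obtain ⟨a1, a2, -, -⟩ := hband x hxB
      exact ⟨a1, a2, hxt.1, by linarith [hxt.2]⟩
    have hcover : Prim ⊆ (Finset.range 8).biUnion fun j =>
        Prim.filter fun p => -8 + (j : ℝ) / 2 ≤ ⟪p, ν⟫_ℝ ∧ ⟪p, ν⟫_ℝ ≤ -8 + ((j : ℝ) + 1) / 2 := by
      intro p hp
      obtain ⟨-, -, h3, h4⟩ := hband p hp
      rw [mem_biUnion]
      -- the band index `j = ⌊2(⟪p,ν⟫ + 8)⌋`, capped at 7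
      by_cases htop : ⟪p, ν⟫_ℝ = -4
      · exact ⟨7, by simp, mem_filter.2 ⟨hp, by rw [htop]; norm_num, by rw [htop]; norm_num⟩⟩
      have h4' : ⟪p, ν⟫_ℝ < -4 := lt_of_le_of_ne h4 htop
      set j := ⌊2 * (⟪p, ν⟫_ℝ + 8)⌋₊ with hj
      have hj0 : (0 : ℝ) ≤ 2 * (⟪p, ν⟫_ℝ + 8) := by linarith
      have hjle : (j : ℝ) ≤ 2 * (⟪p, ν⟫_ℝ + 8) := Nat.floor_le hj0
      have hjlt : 2 * (⟪p, ν⟫_ℝ + 8) < (j : ℝ) + 1 := Nat.lt_floor_add_one _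
      have hj8 : j < 8 := by
        have : (j : ℝ) < 8 := by linarith
        exact_mod_cast this
      exact ⟨j, mem_range.2 hj8, mem_filter.2 ⟨hp, by linarith, by linarith⟩⟩
    have h1 := (card_le_card hcover).trans card_biUnion_le
    have h2 : ((∑ j ∈ Finset.range 8,
        (Prim.filter fun p => -8 + (j : ℝ) / 2 ≤ ⟪p, ν⟫_ℝ ∧ ⟪p, ν⟫_ℝ ≤ -8 + ((j : ℝ) + 1) / 2).card : ℕ) : ℝ) ≤
        ∑ j ∈ Finset.range 8, 16 * (1 + 1) * ρ := by
      rw [Nat.cast_sum]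
      exact sum_le_sum fun j hj => hcount j (mem_range.1 hj)
    rw [sum_const, card_range, nsmul_eq_mul] at h2
    have h1' : (Prim.card : ℝ) ≤ ((∑ j ∈ Finset.range 8,
        (Prim.filter fun p => -8 + (j : ℝ) / 2 ≤ ⟪p, ν⟫_ℝ ∧ ⟪p, ν⟫_ℝ ≤ -8 + ((j : ℝ) + 1) / 2).card : ℕ) : ℝ) := by
      exact_mod_cast h1
    linarith
  -- (4) assemble
  have hkey' : ∀ q ∈ X \ P, 2 * cP q + dF q + S q ≤ 12 + 2 * f q + 2 * B q + I q := fun q hq => by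
    linarith [hkey q hq, hSKI q]
  have hsumkey : ∑ q ∈ X \ P, (2 * cP q + dF q + S q) ≤ ∑ q ∈ X \ P, (12 + 2 * f q + 2 * B q + I q) :=
    sum_le_sum hkey'
  simp only [sum_add_distrib, sum_const, nsmul_eq_mul, ← mul_sum] at hsumkey
  rw [hcross, hdef, hord]
  have hfsum : ∑ q ∈ X \ P, (f q + (1 / 2) * I q) = ∑ q ∈ X \ P,
      (((P.filter fun p => dist q p = 1 ∧ ∀ d ∈ U, ⟪p - q, d⟫_ℝ ≤ Real.sqrt 3 / 2).card : ℝ)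
        + (((X \ P).filter fun x => dist q x = 1 ∧ (∀ d ∈ U, ⟪x - q, d⟫_ℝ ≤ Real.sqrt 3 / 2) ∧
            ⟪x, if -6 < ⟪q, ν⟫_ℝ then ν else -ν⟫_ℝ <
              ⟪q, if -6 < ⟪q, ν⟫_ℝ then ν else -ν⟫_ℝ).card : ℝ)
        + (1 / 2) * (((X \ P).filter fun x => dist q x = 1 ∧ (∀ d ∈ U, ⟪x - q, d⟫_ℝ ≤ Real.sqrt 3 / 2) ∧
            ⟪x, if -6 < ⟪q, ν⟫_ℝ then ν else -ν⟫_ℝ =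
              ⟪q, if -6 < ⟪q, ν⟫_ℝ then ν else -ν⟫_ℝ).card : ℝ)
        - ((U.filter fun d => ⟪d, if -6 < ⟪q, ν⟫_ℝ then ν else -ν⟫_ℝ < 0 ∧
            ∀ x ∈ X, dist q x = 1 → ⟪x - q, d⟫_ℝ ≤ Real.sqrt 3 / 2).card : ℝ)
        - (1 / 2) * ((U.filter fun d => ⟪d, if -6 < ⟪q, ν⟫_ℝ then ν else -ν⟫_ℝ = 0 ∧
            ∀ x ∈ X, dist q x = 1 → ⟪x - q, d⟫_ℝ ≤ Real.sqrt 3 / 2).card : ℝ)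
        + (1 / 2) * (((X \ P).filter fun x => dist q x = 1 ∧
            ¬ ((-6 < ⟪q, ν⟫_ℝ) ↔ (-6 < ⟪x, ν⟫_ℝ)) ∧
            ∃ d ∈ U, 0 < ⟪d, if -6 < ⟪q, ν⟫_ℝ then ν else -ν⟫_ℝ ∧
              Real.sqrt 3 / 2 < ⟪x - q, d⟫_ℝ).card : ℝ)) := by
    rfl
  rw [← hfsum, sum_add_distrib, ← mul_sum]
  linarith [hsumkey, hs0, hBsum, hPrimcard]

end Summit.Ventures.Crystal3D.Theorems

end
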